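import Literature.Geometry.Riemannian.MetricCutoff
import Literature.Geometry.Riemannian.LipschitzSmoothingCompactSupport
import Literature.Geometry.Riemannian.HopfRinowHeineBorel
import Literature.Geometry.Riemannian.CutLocusProofs
import HarnessLib

/-!
# Gaffney's cut-off functions on a complete Riemannian manifold
(Gaffney 1954; Carron 2007, proof of Lemma 1.5)

Third layer of the proof programme of the named fact
`Literature.Geometry.Riemannian.Carron1999_finrank_l2HarmonicOneForms_le` (Carron 1999 = Carron's
habilitation memoir, Thm. 4.3): the point where **completeness** enters every `L²` argument on a
non-compact manifold — the cut-off functions `χ_N(x) = ρ(d(o, x)/N)` of G. Carron, *L² harmonic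
forms on non-compact Riemannian manifolds*, arXiv:0704.3194, proof of Lemma 1.5 (Gaffney's
lemma): "because `(M, g)` is assumed to be complete we know that `B(o, N)` is compact … `χ_N` is a
Lipschitz function … `|dχ_N|(x) ≤ ‖ρ'‖_{L^∞}/N`", used in the memoir, §4.a, proof of Prop. 4.1
("on peut justifier la formule d'intégration par partie") and in the proof of Thm. 4.3. We produce
them SMOOTH (so that they are admissible in the tree's Green identity and Sobolev inequality),
for a smooth Riemannian metric `g` (boundaryless real model of finite dimension) on a connected,
Hausdorff, second countable manifold whose Levi-Civita connection is geodesically complete: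

* `exists_cutoff_of_isGeodesicallyComplete` — **Gaffney's cut-offs**: a universal constant `C₀`
  such that on every connected complete Riemannian manifold, for every centre `p` and scale
  `s > 0`, there is `χ ∈ C^∞_c(M; [0, 1])` with `χ = 1` on `B(p, s/2)`, `tsupport χ ⊆ B(p, s)` and
  `|∇χ|²_g ≤ C₀/s²` everywhere (raw Lipschitz cut-off `exists_raw_cutoff` of `MetricCutoff.lean`,
  compactly supported by Hopf–Rinow `isCompact_setOf_edist_le`, smoothed with gradient control by
  `exists_contMDiff_approx_of_hasCompactSupport` (`LipschitzSmoothingCompactSupport.lean`,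
  Azagra–Ferrera–López-Mesas–Rangel 2007, Thm. 1) and clamped as in `exists_metric_cutoff`);
* `exists_cutoff_seq_of_isGeodesicallyComplete` — the exhausting sequence `χ_N`, `N ∈ ℕ`, of
  such cut-offs at scales `N + 1` about a base point `o`: every point is eventually in the region
  `{χ_N = 1}` (distances on a connected manifold are finite, `edist_lt_top`) and
  `|∇χ_N|²_g ≤ C₀/(N + 1)²` (Carron's "`M = ⋃_N B(o, N)`", "`|dχ_N| ≤ ‖ρ'‖_∞/N`").

Everything is proved; no definitions, no named facts (D-0026).

## References

* M. P. Gaffney, *A special Stokes's theorem for complete Riemannian manifolds*, Ann. of Math. (2)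
  60 (1954), 140–145 (the cut-off argument on complete manifolds). [`Gaffney1954`]
* G. Carron, *L² harmonic forms on non-compact Riemannian manifolds*, arXiv:0704.3194 (2007),
  proof of Lemma 1.5 (the cut-offs `χ_N = ρ(d(o,x)/N)`, `|dχ_N| ≤ ‖ρ'‖_∞/N`). [`Carron2007`]
* G. Carron, *Formes harmoniques L² sur les variétés riemanniennes non-compactes*, mémoire
  d'habilitation (1999) = Rend. Mat. Appl. (7) 21 (2001), §4.a, proof of Prop. 4.1.
  [`Carron1999HdR`]
* D. Azagra, J. Ferrera, F. López-Mesas, Y. Rangel, *Smooth approximation of Lipschitz functions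
  on Riemannian manifolds*, J. Math. Anal. Appl. 326 (2007), 1370–1378, Thm. 1. [`AzagraEtAl2007`]
* B. O'Neill, *Semi-Riemannian geometry*, Academic Press 1983, Ch. 5, Thm. 21 (Hopf–Rinow).
  [`ONeill1983`]
-/

noncomputable section

open Bundle Set Function Filter Manifold
open scoped Manifold ContDiff Topology ENNReal NNReal

namespace Literature.Geometry.Riemannian

open Lorentzian

universe u v w

/-! ### Gaffney's cut-offs on a complete manifold -/

section Complete

/-- **Gaffney's cut-off functions on a complete Riemannian manifold** (Gaffney 1954; Carron 2007,
proof of Lemma 1.5: "`χ_N(x) = ρ(d(o,x)/N)` … the support of `α_N = χ_N α` is included in the ball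
of radius `N` … hence is compact … `|dχ_N|(x) ≤ ‖ρ'‖_{L^∞}/N`"; memoir §4.a, proof of Prop. 4.1).
There is a universal constant `C₀` such that for every smooth Riemannian metric `g` on a connected
Hausdorff second countable manifold without boundary whose Levi-Civita connection is
geodesically complete, every point `p` and every scale `s > 0`, there is a SMOOTH compactly
supported `χ : M → [0, 1]` with `χ = 1` on the ball `{d(p, ·) < s/2}`, `tsupport χ ⊆ {d(p, ·) < s}`
and `|∇χ|²_g ≤ C₀ / s²` everywhere: the `4/s`-Lipschitz raw cut-off `θ(d(p, ·)/s)` of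
`exists_raw_cutoff` is supported in the closed ball of radius `3s/4`, compact by Hopf–Rinow
(`isCompact_setOf_edist_le`), so it can be smoothed with gradient control
(`exists_contMDiff_approx_of_hasCompactSupport`) and clamped (`exists_smooth_clamp`),
exactly as in `exists_metric_cutoff` (closed case); `C₀ = 25 sup|Λ'|²`.
[cite: Carron2007, Lemma 1.5 (proof)] -/
theorem exists_cutoff_of_isGeodesicallyComplete : ∃ C₀ : ℝ,
    ∀ {E : Type u} [NormedAddCommGroup E] [NormedSpace ℝ E] [FiniteDimensional ℝ E]
      {H : Type v} [TopologicalSpace H] (I : ModelWithCorners ℝ E H) [I.Boundaryless]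
      (M : Type w) [TopologicalSpace M] [T2Space M] [SecondCountableTopology M] [ConnectedSpace M]
      [ChartedSpace H M] [IsManifold I ∞ M]
      (g : PseudoRiemannianMetric I ∞ E (TangentSpace I : M → Type _)) [g.HasLeviCivita]
      (hg : g.IsRiemannian), IsGeodesicallyComplete g.leviCivita →
      ∀ (p : M) (s : ℝ), 0 < s → ∃ χ : M → ℝ,
        ContMDiff I 𝓘(ℝ, ℝ) ∞ χ ∧ HasCompactSupport χ ∧ (∀ x, 0 ≤ χ x) ∧ (∀ x, χ x ≤ 1) ∧
        (∀ x, g.edist hg p x < ENNReal.ofReal (s / 2) → χ x = 1) ∧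
        tsupport χ ⊆ {x | g.edist hg p x < ENNReal.ofReal s} ∧
        ∀ x, g.gradSq χ x ≤ C₀ / s ^ 2 := by
  obtain ⟨Λ, C, hC0, hΛs, hΛ0, hΛ1, hΛzero, hΛone, hΛd⟩ := exists_smooth_clamp
  refine ⟨25 * C ^ 2, ?_⟩
  intro E _ _ _ H _ I _ M _ _ _ _ _ _ g _ hg hc p s hs
  haveI : CompleteSpace E := FiniteDimensional.complete ℝ E
  haveI : CovariantDerivative.ContMDiffCovariantDerivative g.leviCivita 1 :=
    ⟨g.isLocallyContMDiff_leviCivita_holds 1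
      (by rw [show ((1 : ℕ∞) : ℕ∞ω) + 1 = 2 by norm_num]; exact WithTop.coe_le_coe.2 le_top)
      univ isOpen_univ⟩
  haveI : LocallyCompactSpace M := Manifold.locallyCompact_of_finiteDimensional I
  haveI : T3Space M := inferInstance
  -- the raw cutoff: continuous, `[0,1]`-valued, `= 1` on `B(p, s/2)`, `> 0` only in `B(p, 3s/4)`
  obtain ⟨F, hFc, hF0, hF1, hFone, hFpos, hFlip⟩ := exists_raw_cutoff hg p hs
  -- it has compact support, by Hopf–Rinow
  have hFk : HasCompactSupport F := by
    refine HasCompactSupport.of_support_subset_isCompact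
      (isCompact_setOf_edist_le g le_rfl hg hc p (3 * s / 4).toNNReal) fun x hx ↦ ?_
    have hx' : 0 < F x := lt_of_le_of_ne (hF0 x) (Ne.symm hx)
    have := hFpos x hx'
    exact this.le
  set ε : ℝ := min (1 / 8) (1 / s) with hε
  have hεpos : 0 < ε := by positivity
  have hε8 : ε ≤ 1 / 8 := min_le_left _ _
  have hεs : ε ≤ 1 / s := min_le_right _ _
  haveI : SigmaCompactSpace M := sigmaCompactSpace_of_locallyCompact_secondCountable
  obtain ⟨χt, hχts, hχtk, -, hχtF, hχtgrad⟩ :=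
    exists_contMDiff_approx_of_hasCompactSupport g hg hFc hFk (by positivity : (0 : ℝ) ≤ 4 / s)
      hFlip isOpen_univ (subset_univ _) hεpos
  -- the clamped cutoff
  refine ⟨fun x ↦ Λ (χt x), hΛs.comp_contMDiff hχts, ?_, fun x ↦ hΛ0 _, fun x ↦ hΛ1 _,
    fun x hx ↦ ?_, ?_, fun x ↦ ?_⟩
  · -- compact support: `Λ 0 = 0`
    exact hχtk.comp_left (hΛzero 0 (by norm_num))
  · -- `= 1` on `B(p, s/2)`: there `F = 1`, so `χt > 7/8 ≥ 3/4`
    have h1 := hFone x hx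
    have h2 := hχtF x
    rw [h1] at h2
    exact hΛone _ (by linarith [(abs_lt.1 h2).1])
  · -- support: `Λ (χt x) ≠ 0 ⇒ χt x > 1/4 ⇒ F x > 0 ⇒ d(p, x) < 3s/4 < s`
    intro x hx
    have hcl : tsupport (fun x ↦ Λ (χt x)) ⊆ {x | 1 / 4 ≤ χt x} := by
      refine closure_minimal (fun y hy ↦ ?_) (isClosed_le continuous_const hχts.continuous)
      by_contra hlt
      simp only [mem_setOf_eq, not_le] at hlt
      exact hy (hΛzero _ hlt.le)
    have hχx : 1 / 4 ≤ χt x := hcl hx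
    have hFx : 0 < F x := by linarith [(abs_lt.1 (hχtF x)).2]
    have hd := hFpos x hFx
    exact hd.trans_le (ENNReal.ofReal_le_ofReal (by linarith))
  · -- gradient: `|∇(Λ ∘ χt)|² = Λ'(χt)² |∇χt|² ≤ C² (4/s + ε)² ≤ 25 C²/s²`
    have hd : HasDerivAt Λ (deriv Λ (χt x)) (χt x) :=
      ((hΛs.differentiable (by simp)) _).hasDerivAt
    have hmd : MDifferentiableAt I 𝓘(ℝ, ℝ) χt x := (hχts x).mdifferentiableAt (by simp)
    rw [show (fun x ↦ Λ (χt x)) = Λ ∘ χt from rfl, g.gradSq_real_comp hd hmd]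
    have h1 : deriv Λ (χt x) ^ 2 ≤ C ^ 2 := by
      rw [← sq_abs]
      exact pow_le_pow_left₀ (abs_nonneg _) (hΛd _) 2
    have h2 : g.gradSq χt x ≤ (5 / s) ^ 2 := by
      refine (hχtgrad x).trans (pow_le_pow_left₀ (by positivity) ?_ 2)
      calc 4 / s + ε ≤ 4 / s + 1 / s := by linarith
        _ = 5 / s := by ring
    have h3 : 0 ≤ g.gradSq χt x := g.gradSq_nonneg hg χt x
    calc deriv Λ (χt x) ^ 2 * g.gradSq χt x ≤ C ^ 2 * (5 / s) ^ 2 :=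
          mul_le_mul h1 h2 h3 (sq_nonneg _)
      _ = 25 * C ^ 2 / s ^ 2 := by ring

/-- **The exhausting sequence of Gaffney cut-offs** (Carron 2007, proof of Lemma 1.5: "we fix now
an origin `o ∈ M` and denote by `B(o, N)` the closed geodesic ball … `M = ⋃_{N ∈ ℕ} B(o, N)` …
`χ_N(x) = ρ(d(o, x)/N)` … `|dχ_N|(x) ≤ ‖ρ'‖_{L^∞}/N`"). With the universal constant `C₀` of
`exists_cutoff_of_isGeodesicallyComplete`: on a connected complete Riemannian manifold, for every
base point `o` there are `χ_N ∈ C^∞_c(M; [0, 1])`, `N ∈ ℕ`, with `χ_N = 1` on `B(o, (N+1)/2)` — so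
that every point `x` has `χ_N(x) = 1` for all large `N`, the distance `d(o, x)` being finite on a
connected manifold — and `|∇χ_N|²_g ≤ C₀/(N + 1)²` everywhere.
[cite: Carron2007, Lemma 1.5 (proof)] -/
theorem exists_cutoff_seq_of_isGeodesicallyComplete : ∃ C₀ : ℝ,
    ∀ {E : Type u} [NormedAddCommGroup E] [NormedSpace ℝ E] [FiniteDimensional ℝ E]
      {H : Type v} [TopologicalSpace H] (I : ModelWithCorners ℝ E H) [I.Boundaryless]
      (M : Type w) [TopologicalSpace M] [T2Space M] [SecondCountableTopology M] [ConnectedSpace M]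
      [ChartedSpace H M] [IsManifold I ∞ M]
      (g : PseudoRiemannianMetric I ∞ E (TangentSpace I : M → Type _)) [g.HasLeviCivita]
      (hg : g.IsRiemannian), IsGeodesicallyComplete g.leviCivita →
      ∀ o : M, ∃ χ : ℕ → M → ℝ,
        (∀ N, ContMDiff I 𝓘(ℝ, ℝ) ∞ (χ N)) ∧ (∀ N, HasCompactSupport (χ N)) ∧
        (∀ N x, 0 ≤ χ N x) ∧ (∀ N x, χ N x ≤ 1) ∧
        (∀ (N : ℕ) (x : M), g.edist hg o x < ENNReal.ofReal (((N : ℝ) + 1) / 2) → χ N x = 1) ∧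
        (∀ x, ∀ᶠ N in atTop, χ N x = 1) ∧
        ∀ N x, g.gradSq (χ N) x ≤ C₀ / ((N : ℝ) + 1) ^ 2 := by
  obtain ⟨C₀, hC₀⟩ := exists_cutoff_of_isGeodesicallyComplete.{u, v, w}
  refine ⟨C₀, ?_⟩
  intro E _ _ _ H _ I _ M _ _ _ _ _ _ g _ hg hc o
  have h := fun N : ℕ ↦ hC₀ I M g hg hc o ((N : ℝ) + 1) (by positivity)
  choose χ hχs hχk hχ0 hχ1 hχone _ hχgrad using h
  refine ⟨χ, hχs, hχk, hχ0, hχ1, fun N x hx ↦ hχone N x hx, fun x ↦ ?_, hχgrad⟩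
  -- `d(o, x) < ∞`, so `d(o, x) < (N + 1)/2` for all large `N`
  have hfin : g.edist hg o x ≠ ⊤ := (PseudoRiemannianMetric.edist_lt_top hg o x).ne
  set d : ℝ := (g.edist hg o x).toReal with hd
  refine eventually_atTop.2 ⟨⌈2 * d⌉₊, fun N hN ↦ hχone N x ?_⟩
  rw [← ENNReal.ofReal_toReal hfin]
  refine (ENNReal.ofReal_lt_ofReal_iff (by positivity)).2 ?_
  have h1 : 2 * d ≤ ⌈2 * d⌉₊ := Nat.le_ceil _
  have h2 : (⌈2 * d⌉₊ : ℝ) ≤ N := by exact_mod_cast hN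
  rw [← hd]; linarith

end Complete

end Literature.Geometry.Riemannian

end
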